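import Literature.Probability.Percolation.FKLoopNestingPercolationBridge
import HarnessLib

/-!
# The measure in DKLM Corollary 10 is pinned: uniqueness of the free random-cluster limit

Companion of `Literature.Probability.Percolation.FKLoopNestingGaussianLimit` (the named fact
`dklm2026_corollary10`, Duminil-Copin–Kozlowski–Lammers–Manolescu, arXiv:2603.06268, Cor. 10).
That fact quantifies over *every* probability measure `P` on the bond configurations of `ℤ²`
with `IsFreeRandomClusterLimit (rcSelfDualPoint q) q P` (the cylinder probabilities of `P` are the
limits of those of the free box measures `φ⁰_{Λ_n,p,q}`), whereas the source speaks of *the*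
measure `φ_{ℤ²,q}`. Here we PROVE the bookkeeping fact that makes the two readings identical:

* `measurableSet_cylinderEvent`, `isPiSystem_cylinderEvent`, `generateFrom_cylinderEvent` — the
  cylinder events `{ω | ω ∩ E₀ = S ∩ E₀}` (`cylinderEvent E₀ S`) are measurable, form a π-system
  and generate the product σ-algebra of `BondConfig (Site 2) = Set (Sym2 (Site 2))`
  (Grimmett 2006, §4.1: "`𝓕` is the σ-field generated by the finite-dimensional cylinders");
* `IsFreeRandomClusterLimit.unique` — two free infinite-volume random-cluster limits with the
  same parameters are EQUAL (limits of real sequences are unique, then π–λ through Mathlib's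
  `MeasureTheory.ext_of_generate_finite`); so the `∀ P` of `dklm2026_corollary10` ranges over at
  most one measure, the weak limit `φ⁰_{p,q} = lim_{Λ ↑ ℤ²} φ⁰_{Λ,p,q}` of Grimmett's Thm. (4.19)(a)
  whenever it exists;
* `IsFreeRandomClusterLimit.eq_bondPercolation_half` — consequently, at `(p, q) = (1/2, 1)` every
  such `P` IS Mathlib's product measure `bondPercolation (zdGraph 2) half` (critical bond
  percolation; existence at `q = 1` is `isFreeRandomClusterLimit_bondPercolation_half` of
  `FKLoopNestingPercolationBridge`), and the `q = 1` instance of Cor. 10 for all free limits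
  reduces to the single statement about that measure
  (`tendsto_integral_loopNestingWeight_one_iff_bondPercolation`), which is the form used by the
  consumer route `Summits/CriticalPhenomena/CardyFormulaZ2/Theses/CardyMagicRigidity.lean`.

Nothing is assumed; no named fact is introduced.

## References

* G. Grimmett, *The Random-Cluster Model*, Springer 2006: §4.1 (the σ-field generated by the
  finite-dimensional cylinders), Thm. (4.19)(a) (existence of the free limit for `q ≥ 1`).
  [Grimmett2006]
* H. Duminil-Copin, K. K. Kozlowski, P. Lammers, I. Manolescu, arXiv:2603.06268 (2026), Cor. 10.
  [DuminilCopinKozlowskiLammersManolescu2026]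
-/

noncomputable section

open MeasureTheory Set Filter
open scoped Topology

namespace Literature.Probability.Percolation

open LatticeModels

/-! ### Cylinder events: measurability, π-system, generation -/

/-- A cylinder event is measurable for the product σ-algebra (a finite intersection of
coordinate events and their complements). [cite: Grimmett2006, §4.1] -/
theorem measurableSet_cylinderEvent (E₀ S : Finset (Sym2 (Site 2))) :
    MeasurableSet (cylinderEvent E₀ S) := by
  have h : cylinderEvent E₀ S = ⋂ e ∈ E₀, {ω : BondConfig (Site 2) | e ∈ ω ↔ e ∈ S} := by
    ext ω
    simp only [mem_cylinderEvent_iff, Set.mem_iInter, Set.mem_setOf_eq]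
  rw [h]
  refine Finset.measurableSet_biInter E₀ fun e _ => ?_
  by_cases he : e ∈ S
  · simp only [he, iff_true]
    exact measurableSet_mem e
  · simp only [he, iff_false]
    exact measurableSet_notMem e

/-- Two cylinder events with a common configuration `ω` intersect in a cylinder event: the one
prescribing, on `E₀ ∪ E₁`, the states read off from `ω`. [folklore] -/
theorem cylinderEvent_inter_eq [DecidableEq (Sym2 (Site 2))]
    {E₀ S E₁ S' : Finset (Sym2 (Site 2))} {ω : BondConfig (Site 2)} [DecidablePred (· ∈ ω)]
    (h₀ : ω ∈ cylinderEvent E₀ S) (h₁ : ω ∈ cylinderEvent E₁ S') :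
    cylinderEvent E₀ S ∩ cylinderEvent E₁ S' =
      cylinderEvent (E₀ ∪ E₁) ((E₀ ∪ E₁).filter (· ∈ ω)) := by
  rw [mem_cylinderEvent_iff] at h₀ h₁
  ext ω'
  simp only [Set.mem_inter_iff, mem_cylinderEvent_iff, Finset.mem_union, Finset.mem_filter]
  constructor
  · rintro ⟨h₀', h₁'⟩ e he
    rcases he with he | he
    · rw [h₀' e he, ← h₀ e he]
      exact ⟨fun h => ⟨Or.inl he, h⟩, fun h => h.2⟩
    · rw [h₁' e he, ← h₁ e he]
      exact ⟨fun h => ⟨Or.inr he, h⟩, fun h => h.2⟩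
  · intro h
    refine ⟨fun e he => ?_, fun e he => ?_⟩
    · rw [h e (Or.inl he), ← h₀ e he]
      exact ⟨fun h' => h'.2, fun h' => ⟨Or.inl he, h'⟩⟩
    · rw [h e (Or.inr he), ← h₁ e he]
      exact ⟨fun h' => h'.2, fun h' => ⟨Or.inr he, h'⟩⟩

/-- **The cylinder events form a π-system.** [cite: Grimmett2006, §4.1] -/
theorem isPiSystem_cylinderEvent :
    IsPiSystem (Set.range fun p : Finset (Sym2 (Site 2)) × Finset (Sym2 (Site 2)) =>
      cylinderEvent p.1 p.2) := by
  classical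
  rintro _ ⟨⟨E₀, S⟩, rfl⟩ _ ⟨⟨E₁, S'⟩, rfl⟩ ⟨ω, h₀, h₁⟩
  exact ⟨⟨E₀ ∪ E₁, (E₀ ∪ E₁).filter (· ∈ ω)⟩, (cylinderEvent_inter_eq h₀ h₁).symm⟩

/-- A coordinate event `{ω | e ∈ ω}` is the cylinder event `cylinderEvent {e} {e}`. [folklore] -/
theorem setOf_mem_eq_cylinderEvent (e : Sym2 (Site 2)) :
    {ω : BondConfig (Site 2) | e ∈ ω} = cylinderEvent {e} {e} := by
  ext ω
  simp only [Set.mem_setOf_eq, mem_cylinderEvent_iff, Finset.mem_singleton, forall_eq, iff_true]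

/-- A negated coordinate event `{ω | e ∉ ω}` is the cylinder event `cylinderEvent {e} ∅`. [folklore] -/
theorem setOf_notMem_eq_cylinderEvent (e : Sym2 (Site 2)) :
    {ω : BondConfig (Site 2) | e ∉ ω} = cylinderEvent {e} ∅ := by
  ext ω
  simp only [Set.mem_setOf_eq, mem_cylinderEvent_iff, Finset.mem_singleton, forall_eq,
    Finset.notMem_empty, iff_false]

/-- **The cylinder events generate the product σ-algebra** on `BondConfig (Site 2)`
(`Set.instMeasurableSpace`, generated by the coordinate events `{ω | e ∈ ω}`, each of which is a
cylinder event). [cite: Grimmett2006, §4.1] -/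
theorem generateFrom_cylinderEvent :
    MeasurableSpace.generateFrom (Set.range fun p : Finset (Sym2 (Site 2)) × Finset (Sym2 (Site 2)) =>
        cylinderEvent p.1 p.2) =
      (Set.instMeasurableSpace : MeasurableSpace (BondConfig (Site 2))) := by
  refine le_antisymm (MeasurableSpace.generateFrom_le ?_) ?_
  · rintro _ ⟨⟨E₀, S⟩, rfl⟩
    exact measurableSet_cylinderEvent E₀ S
  · -- the product σ-algebra is generated by the coordinate maps `ω ↦ (e ∈ ω) : Prop`
    have hpi : (Set.instMeasurableSpace : MeasurableSpace (Set (Sym2 (Site 2)))) =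
        MeasurableSpace.generateFrom {B : Set (Sym2 (Site 2) → Prop) |
          ∃ (i : Sym2 (Site 2)) (A : Set Prop), MeasurableSet A ∧ Function.eval i ⁻¹' A = B} :=
      MeasurableSpace.pi_eq_generateFrom_projections (α := fun _ : Sym2 (Site 2) => Prop)
    rw [hpi]
    refine MeasurableSpace.generateFrom_le fun B hB => ?_
    obtain ⟨i, A, -, rfl⟩ := hB
    -- the two coordinate events at `i` are cylinder events, hence measurable for `σ(cylinders)`
    have hT : MeasurableSet[MeasurableSpace.generateFrom
        (Set.range fun p : Finset (Sym2 (Site 2)) × Finset (Sym2 (Site 2)) =>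
          cylinderEvent p.1 p.2)] {ω : BondConfig (Site 2) | i ∈ ω} := by
      rw [setOf_mem_eq_cylinderEvent]
      exact MeasurableSpace.measurableSet_generateFrom ⟨⟨{i}, {i}⟩, rfl⟩
    have hF : MeasurableSet[MeasurableSpace.generateFrom
        (Set.range fun p : Finset (Sym2 (Site 2)) × Finset (Sym2 (Site 2)) =>
          cylinderEvent p.1 p.2)] {ω : BondConfig (Site 2) | i ∉ ω} := by
      rw [setOf_notMem_eq_cylinderEvent]
      exact MeasurableSpace.measurableSet_generateFrom ⟨⟨{i}, ∅⟩, rfl⟩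
    -- `eval i ⁻¹' A` is one of `∅`, `{i ∈ ω}`, `{i ∉ ω}`, `univ` according to `True ∈ A`, `False ∈ A`
    have key : Function.eval i ⁻¹' A =
        {ω : BondConfig (Site 2) | (i ∈ ω ∧ True ∈ A) ∨ (i ∉ ω ∧ False ∈ A)} := by
      refine Set.ext fun (ω : BondConfig (Site 2)) => ?_
      simp only [Set.mem_preimage]
      rcases Classical.propComplete (Function.eval i ω) with h | h
      · have hi : i ∈ ω := by
          change Function.eval i ω
          rw [h]
          trivial
        rw [h]
        exact ⟨fun hA => Or.inl ⟨hi, hA⟩,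
          fun h' => h'.elim (fun h'' => h''.2) fun h'' => absurd hi h''.1⟩
      · have hi : i ∉ ω := by
          change ¬ Function.eval i ω
          rw [h]
          exact not_false
        rw [h]
        exact ⟨fun hA => Or.inr ⟨hi, hA⟩,
          fun h' => h'.elim (fun h'' => absurd h''.1 hi) fun h'' => h''.2⟩
    rw [key]
    by_cases hTA : True ∈ A <;> by_cases hFA : False ∈ A
    · have : {ω : BondConfig (Site 2) | (i ∈ ω ∧ True ∈ A) ∨ (i ∉ ω ∧ False ∈ A)} = Set.univ := by
        ext ω
        simp only [hTA, hFA, and_true, Set.mem_setOf_eq, Set.mem_univ, iff_true]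
        exact Classical.em _
      rw [this]
      exact MeasurableSet.univ
    · have : {ω : BondConfig (Site 2) | (i ∈ ω ∧ True ∈ A) ∨ (i ∉ ω ∧ False ∈ A)} =
          {ω : BondConfig (Site 2) | i ∈ ω} := by
        ext ω
        simp only [hTA, hFA, and_true, and_false, or_false, Set.mem_setOf_eq]
      rw [this]
      exact hT
    · have : {ω : BondConfig (Site 2) | (i ∈ ω ∧ True ∈ A) ∨ (i ∉ ω ∧ False ∈ A)} =
          {ω : BondConfig (Site 2) | i ∉ ω} := by
        ext ω
        simp only [hTA, hFA, and_true, and_false, false_or, Set.mem_setOf_eq]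
      rw [this]
      exact hF
    · have : {ω : BondConfig (Site 2) | (i ∈ ω ∧ True ∈ A) ∨ (i ∉ ω ∧ False ∈ A)} = ∅ := by
        ext ω
        simp only [hTA, hFA, and_false, or_false, Set.mem_setOf_eq, Set.mem_empty_iff_false]
      rw [this]
      exact @MeasurableSet.empty _ (MeasurableSpace.generateFrom _)

/-! ### Uniqueness of the free infinite-volume random-cluster limit -/

/-- Two free infinite-volume random-cluster limits with the same parameters give every cylinder
event the same probability (limits of a real sequence are unique). [cite: Grimmett2006, Thm. (4.19)(a)] -/
theorem IsFreeRandomClusterLimit.measure_cylinderEvent_eq {p q : ℝ}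
    {P P' : Measure (BondConfig (Site 2))}
    (hP : IsFreeRandomClusterLimit p q P) (hP' : IsFreeRandomClusterLimit p q P')
    (E₀ S : Finset (Sym2 (Site 2))) :
    P (cylinderEvent E₀ S) = P' (cylinderEvent E₀ S) := by
  haveI := hP.isProbabilityMeasure
  haveI := hP'.isProbabilityMeasure
  have h : P.real (cylinderEvent E₀ S) = P'.real (cylinderEvent E₀ S) :=
    tendsto_nhds_unique (hP.tendsto_cylinder E₀ S) (hP'.tendsto_cylinder E₀ S)
  rw [measureReal_def, measureReal_def] at h
  exact (ENNReal.toReal_eq_toReal_iff' (measure_ne_top _ _) (measure_ne_top _ _)).1 h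

/-- **The free infinite-volume random-cluster limit on `ℤ²` is unique**: two probability
measures whose cylinder probabilities are both the limits of those of the free box measures
`φ⁰_{Λ_n,p,q}` coincide (the cylinder events are a generating π-system). Hence the universally
quantified measure `P` of `dklm2026_corollary10` is *the* free random-cluster measure
`φ⁰_{p_sd(q),q}` whenever the latter exists (Grimmett 2006, Thm. (4.19)(a), `q ≥ 1`).
[cite: Grimmett2006, §4.1 and Thm. (4.19)(a)] -/
theorem IsFreeRandomClusterLimit.unique {p q : ℝ} {P P' : Measure (BondConfig (Site 2))}
    (hP : IsFreeRandomClusterLimit p q P) (hP' : IsFreeRandomClusterLimit p q P') : P = P' := by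
  haveI := hP.isProbabilityMeasure
  haveI := hP'.isProbabilityMeasure
  refine ext_of_generate_finite _ generateFrom_cylinderEvent.symm isPiSystem_cylinderEvent
    ?_ (by rw [measure_univ, measure_univ])
  rintro _ ⟨⟨E₀, S⟩, rfl⟩
  exact hP.measure_cylinderEvent_eq hP' E₀ S

/-! ### At `q = 1`: every free limit is critical bond percolation -/

/-- **At `(p, q) = (1/2, 1)` every free infinite-volume random-cluster limit is critical bond
percolation** `bondPercolation (zdGraph 2) half` (uniqueness, and
`isFreeRandomClusterLimit_bondPercolation_half`). [cite: Grimmett2006, §1.2 pp. 4–6 and Thm. (4.19)(a)] -/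
theorem IsFreeRandomClusterLimit.eq_bondPercolation_half {P : Measure (BondConfig (Site 2))}
    (hP : IsFreeRandomClusterLimit (1 / 2) 1 P) : P = bondPercolation (zdGraph 2) half :=
  hP.unique isFreeRandomClusterLimit_bondPercolation_half

/-- The same with the parameter written as the self-dual point `p_sd(1)` (the form of the
hypothesis of `dklm2026_corollary10` at `q = 1`). [cite: Grimmett2006, (6.9) and Thm. (4.19)(a)] -/
theorem IsFreeRandomClusterLimit.eq_bondPercolation_half_of_rcSelfDualPoint_one
    {P : Measure (BondConfig (Site 2))} (hP : IsFreeRandomClusterLimit (rcSelfDualPoint 1) 1 P) :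
    P = bondPercolation (zdGraph 2) half := by
  rw [rcSelfDualPoint_one] at hP
  exact hP.eq_bondPercolation_half

/-- **Reduction of Cor. 10 at `q = 1` to bond percolation.** The `q = 1` instance of
`dklm2026_corollary10` — a statement about every free random-cluster limit `P` at
`(p_sd(1), 1)` — holds (for a given test measure `φ` and limit value `L`) if and only if it holds
for the single measure `bondPercolation (zdGraph 2) half` of the consumer route
`CardyFormulaZ2/CardyMagicRigidity`. [cite: DuminilCopinKozlowskiLammersManolescu2026, Cor. 10 (q = 1)] -/
theorem tendsto_integral_loopNestingWeight_one_iff_bondPercolation (φ : SignedMeasure ℂ) (L : ℝ) :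
    (∀ P : Measure (BondConfig (Site 2)), IsFreeRandomClusterLimit (rcSelfDualPoint 1) 1 P →
        Tendsto (fun δ : ℝ ↦ ∫ ω, loopNestingWeight 1 φ δ ω ∂P) (𝓝[>] 0) (𝓝 L)) ↔
      Tendsto (fun δ : ℝ ↦ ∫ ω, loopNestingWeight 1 φ δ ω ∂(bondPercolation (zdGraph 2) half))
        (𝓝[>] 0) (𝓝 L) := by
  constructor
  · intro h
    exact h _ isFreeRandomClusterLimit_rcSelfDualPoint_one_bondPercolation_half
  · intro h P hP
    rw [hP.eq_bondPercolation_half_of_rcSelfDualPoint_one]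
    exact h

end Literature.Probability.Percolation

end
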